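import Summits.AtomisticToContinuum.FouriersLaw.Theses.CoercivePulse
import Summits.AtomisticToContinuum.FouriersLaw.Theorems.HoelderEscapeProfileAbelSpreadCeilingFixedTimeRegularity
import Literature.MathematicalPhysics.KineticTheory.InfiniteChainGibbsExistenceShift
import Literature.MathematicalPhysics.KineticTheory.InfiniteChainSuperstableReversal
import Literature.MathematicalPhysics.KineticTheory.InfiniteChainGibbsInvariance
import Literature.MathematicalPhysics.KineticTheory.InfiniteChainShiftInvariantUniqueness
import Summits.AtomisticToContinuum.FouriersLaw.Theorems.LinearSpread.Negative.LoadBearing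
import Summits.AtomisticToContinuum.FouriersLaw.Theorems.LinearSpread.Negative.LacunarySpread
import Summits.AtomisticToContinuum.FouriersLaw.Theorems.LinearSpread.Negative.LacunarySpreadEnvelope

/-!
# Disproof of `LinearSpread` — findings (cdisprove seat, crux stmt-AtomisticToContinuum-15382, route CoercivePulse)

Work file of the crux disprover.  Prose lives in docstrings only.  Index:

* §1 `LinearSpreadWithoutGibbs` / `linearSpread_false_without_gibbs` — LOAD-BEARING ANALYSIS: the DLR–Gibbs
  hypothesis cannot be weakened to "flow-invariant, shift- and reversal-invariant probability measure":
  the frozen chain (Dirac mass at the zero configuration, identity flow on the carrier `{0}`) satisfies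
  every other hypothesis of the crux with `S ≡ 0`, hence `M ≡ 0`.  Any proof must use a NON-DEGENERACY
  consequence of DLR (absolutely continuous finite-volume conditionals ⇒ `χ = Σ_x Cov(h_0,h_x) > 0`).
  LANDED: `Theorems/LinearSpread/Negative/LoadBearing.lean` (p167110).
* §2 `LinearSpreadWithoutCarrierAE` / `linearSpread_false_without_carrierAE` — LOAD-BEARING ANALYSIS: the clause
  `∀ᵐ σ ∂μ, σ ∈ D.carrier` of `PreservesMeasure` (a.e. orbit solves Newton's equations) cannot be dropped: in the
  GENUINE DLR state the idle dynamics (empty carrier, `φ_t = id`) preserves `μ`, commutes with the shift, and has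
  `M(t) = M(0)`.  LANDED: same file (p167110).
* §3 LINE `KaramataCollapse` (joint sufficiency / natural strengthening, LANDED as
  `Theorems/LinearSpread/Negative/LacunarySpread.lean` p167440 + `…/LacunarySpreadEnvelope.lean` p167650): the
  super-lacunary spectral measure `ρ = Σₙ (4pₙ)⁻¹ δ_{1/pₙ}`, `pₙ = 2^(2ⁿ)`, has heat variance
  `V(τ) = Σₙ (pₙ/2)(1 - cos(τ/pₙ))` with CEILING `V ≤ 4(1+τ)`, IO `V(πp_N) ≥ p_N`, DIPS `V(2πp_N) ≤ 20`; hence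
  (i) `not_linearEnvelope_of_io_and_ceiling`: IO ∧ LinearCeiling ∧ positive type ⇏ LinearSpread-shape — the line's
  `stub_abelRegularity` is LOAD-BEARING, a proof along it must use zero-frequency non-oscillation of the current
  spectral measure; (ii) `stub_karamataCollapse_false_without_abel`: stub K minus its Abel hypothesis is FALSE;
  (iii) `superlacunary_abelMeans_oscillate`: the explicit enemy of the route — Ceiling TRUE, IO TRUE, LinearSpread
  FALSE, AbelRegularity FALSE (read through the landed K).
* §4 WHY THE CRUX RESISTS (no kill): the arena is instantiable and RIGID in tree — the shift-invariant DLR state is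
  unique (`eq_of_isChainGibbsMeasure_of_isShiftInvariant_pinnedChain`), every preserving `D` equals the canonical
  Buttà–Marchioro dynamics a.e. (`HeatVarianceCalculus.CanonicalRigidity.flow_ae_eq_canonical`), stubs K, I, H of
  the line are landed — so `¬LinearSpread` is EQUIVALENT to sub-diffusive spread `M(t) = o(t)` along a sequence for
  the ONE true quartic chain at some `(ω₂,lam,β,T)`: physically false (normal conduction of pinned anharmonic
  chains; ideator MD j024566: `V` convex to `t = 60`, `V(60)/60 ≈ 15–22` at `T = 1`, `lam = β ∈ {0.2,1,5}`), and not
  constructible.  Idle hypotheses (information for provers): momentum-reversal invariance of `μ` (automatic by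
  uniqueness, `map_momentumReversalZ_eq_of_regular_unique`), a.e. shift-covariance of `D` (automatic for `D♭`,
  transfers by rigidity), `0 < T` (`isChainGibbsMeasure_pinnedChain_temp_pos`: `T ≤ 0` is vacuous); NOT idle:
  DLR (§1), carrier clause (§2); `0 < lam`, `0 < β` are idle FOR THIS CRUX (harmonic member: `M ≈ 0.19t²`,
  LinearSpread true) but load-bearing for the sibling `LinearCeiling`.
-/

noncomputable section

namespace Summit.AtomisticToContinuum.FouriersLaw.Cruxes.LinearSpread.Disproof

open MeasureTheory Filter Set Function
open scoped Topology BigOperators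
open Literature.MathematicalPhysics.KineticTheory.HeatConduction

/-! ## §1  The Gibbs hypothesis is load-bearing (frozen-chain witness) -/

/-- `LinearSpread` with the DLR–Gibbs hypothesis `IsChainGibbsMeasure T μ` WEAKENED to
`IsProbabilityMeasure μ`; every other binder and hypothesis is copied verbatim from
`CoercivePulse.LinearSpread`. -/
def LinearSpreadWithoutGibbs : Prop :=
  ∀ ω₂ lam β γ : ℝ, 0 < ω₂ → 0 < lam → 0 < β → ∀ T : ℝ, 0 < T →
  ∀ μ : Measure ChainConfig, IsProbabilityMeasure μ → IsShiftInvariant μ →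
  μ.map (fun σ : ChainConfig => fun x : ℤ => ((σ x).1, -(σ x).2)) = μ →
  ∀ D : InfiniteChainDynamics (pinnedChain ω₂ lam β γ), D.PreservesMeasure μ →
  (∀ t : ℝ, ∀ᵐ σ ∂μ, D.flow t (shift σ) = shift (D.flow t σ)) →
  ∀ h : ChainConfig → ℤ → ℝ, h = (fun (σ : ChainConfig) (x : ℤ) => (σ x).2 ^ 2 / 2 +
    (pinnedChain ω₂ lam β γ).U (σ x).1 + ((pinnedChain ω₂ lam β γ).V ((σ (x + 1)).1 - (σ x).1) +
    (pinnedChain ω₂ lam β γ).V ((σ x).1 - (σ (x - 1)).1)) / 2) →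
  ∀ S : ℤ → ℝ → ℝ, S = (fun (x : ℤ) (t : ℝ) => ∫ σ, (h σ 0 - ∫ σ', h σ' 0 ∂μ) *
    (h (D.flow t σ) x - ∫ σ', h σ' 0 ∂μ) ∂μ) →
  (∀ t : ℝ, Summable (fun x : ℤ => (1 + (x : ℝ) ^ 2) * |S x t|)) →
  ∃ m t₂ : ℝ, 0 < m ∧ ∀ t : ℝ, t₂ ≤ t → m * t ≤ ∑' x : ℤ, (x : ℝ) ^ 2 * S x t

/-- The zero configuration `q ≡ 0, p ≡ 0` (the frozen chain). -/
def zeroConfig : ChainConfig := fun _ => (0, 0)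

/-- `U'(0) = 0` for the pinned chain `U(q) = ω₂q²/2 + lam q⁴/4`. [folklore] -/
theorem deriv_U_pinnedChain_zero (ω₂ lam β γ : ℝ) : deriv (pinnedChain ω₂ lam β γ).U 0 = 0 := by
  have h : HasDerivAt (fun q : ℝ => ω₂ * q ^ 2 / 2 + lam * q ^ 4 / 4)
      (ω₂ * ((2 : ℕ) * (0 : ℝ) ^ (2 - 1)) / 2 + lam * ((4 : ℕ) * (0 : ℝ) ^ (4 - 1)) / 4) 0 :=
    (((hasDerivAt_pow 2 (0 : ℝ)).const_mul ω₂).div_const 2).add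
      (((hasDerivAt_pow 4 (0 : ℝ)).const_mul lam).div_const 4)
  show deriv (fun q : ℝ => ω₂ * q ^ 2 / 2 + lam * q ^ 4 / 4) 0 = 0
  rw [h.deriv]
  norm_num

/-- The FROZEN dynamics of a chain with `U'(0) = 0`: carrier `{0}`, identity flow.  It is an
`InfiniteChainDynamics` because the structure constrains the flow only on the carrier, where the
constant zero orbit solves the equations of motion. [folklore] -/
def frozenDynamics (P : OscillatorChain) (hU : deriv P.U 0 = 0) : InfiniteChainDynamics P where
  carrier := {zeroConfig}
  flow := fun _ σ => σ
  mapsTo := fun _ _ hσ => hσ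
  flow_zero := fun _ _ => rfl
  isSolution := fun σ hσ => by
    rw [Set.mem_singleton_iff] at hσ
    subst hσ
    exact P.isSolution_const_zero hU
  unique := fun γ hγ _ t => by
    have h1 := hγ t
    have h0 := hγ 0
    rw [Set.mem_singleton_iff] at h1 h0
    rw [h1, h0]

/-- The Dirac mass at the frozen configuration is shift invariant. [folklore] -/
theorem isShiftInvariant_dirac_zeroConfig : IsShiftInvariant (Measure.dirac zeroConfig) := by
  unfold IsShiftInvariant
  rw [Measure.map_dirac]
  rfl

/-- The Dirac mass at the frozen configuration is momentum-reversal invariant. [folklore] -/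
theorem map_reversal_dirac_zeroConfig :
    (Measure.dirac zeroConfig).map (fun σ : ChainConfig => fun x : ℤ => ((σ x).1, -(σ x).2)) =
      Measure.dirac zeroConfig := by
  rw [Measure.map_dirac]
  congr 1
  funext x
  simp [zeroConfig]

/-- The frozen dynamics preserves the Dirac mass at the frozen configuration. [folklore] -/
theorem preservesMeasure_frozen (P : OscillatorChain) (hU : deriv P.U 0 = 0) :
    (frozenDynamics P hU).PreservesMeasure (Measure.dirac zeroConfig) := by
  refine ⟨?_, fun _ => MeasurePreserving.id _⟩
  rw [ae_dirac_eq]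
  show zeroConfig ∈ ({zeroConfig} : Set ChainConfig)
  exact Set.mem_singleton _

/-- **The Gibbs hypothesis of `LinearSpread` is load-bearing.**  With `IsChainGibbsMeasure` weakened
to `IsProbabilityMeasure`, the statement is FALSE: witness `ω₂ = lam = β = T = 1`, `γ = 0`,
`μ = δ_0` (Dirac mass at the zero configuration: a shift-, reversal- and flow-invariant probability
measure), `D` = the frozen dynamics (carrier `{0}`, identity flow — a legitimate
`InfiniteChainDynamics`, unique on its carrier).  Then `S ≡ 0`, the guard `Σ(1+x²)|S| < ∞` holds,
`M(t) = Σ x²S(x,t) = 0`, and no `m > 0` has `m·t ≤ 0` for large `t`.  Moral for provers: the only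
hypothesis of the crux that excludes frozen / zero-fluctuation states is DLR; a proof must extract
from it a quantitative non-degeneracy (e.g. `χ_T = Σ_x Cov(h_0,h_x) > 0`, or `M(0) > 0` and
`M − M(0) = V ≥ 0` is NOT enough — linear GROWTH needs more than positivity of the static
susceptibility). [folklore] -/
theorem linearSpread_false_without_gibbs : ¬ LinearSpreadWithoutGibbs := by
  intro H
  set P : OscillatorChain := pinnedChain 1 1 1 0 with hP
  have hU : deriv P.U 0 = 0 := deriv_U_pinnedChain_zero 1 1 1 0
  set D : InfiniteChainDynamics P := frozenDynamics P hU with hD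
  set μ₀ : Measure ChainConfig := Measure.dirac zeroConfig with hμ₀
  haveI : IsProbabilityMeasure μ₀ := by rw [hμ₀]; infer_instance
  have hcov : ∀ t : ℝ, ∀ᵐ σ ∂μ₀, D.flow t (shift σ) = shift (D.flow t σ) :=
    fun t => Eventually.of_forall fun σ => rfl
  obtain ⟨hE, hhE⟩ : ∃ hE : ChainConfig → ℤ → ℝ, hE = (fun (σ : ChainConfig) (x : ℤ) =>
      (σ x).2 ^ 2 / 2 + P.U (σ x).1 + (P.V ((σ (x + 1)).1 - (σ x).1) +
        P.V ((σ x).1 - (σ (x - 1)).1)) / 2) := ⟨_, rfl⟩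
  obtain ⟨SE, hSE⟩ : ∃ SE : ℤ → ℝ → ℝ, SE = (fun (x : ℤ) (t : ℝ) =>
      ∫ σ, (hE σ 0 - ∫ σ', hE σ' 0 ∂μ₀) * (hE (D.flow t σ) x - ∫ σ', hE σ' 0 ∂μ₀) ∂μ₀) := ⟨_, rfl⟩
  -- the pulse of the frozen chain vanishes identically
  have hS0 : ∀ (x : ℤ) (t : ℝ), SE x t = 0 := by
    intro x t
    rw [hSE]
    beta_reduce
    rw [hμ₀]
    simp only [integral_dirac]
    ring
  have hsum : ∀ t : ℝ, Summable (fun x : ℤ => (1 + (x : ℝ) ^ 2) * |SE x t|) := fun t => by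
    simp only [hS0, abs_zero, mul_zero]
    exact summable_zero
  obtain ⟨m, t₂, hm, hmt⟩ := H 1 1 1 0 one_pos one_pos one_pos 1 one_pos μ₀ inferInstance
    (by rw [hμ₀]; exact isShiftInvariant_dirac_zeroConfig)
    (by rw [hμ₀]; exact map_reversal_dirac_zeroConfig) D
    (by rw [hμ₀, hD]; exact preservesMeasure_frozen P hU) hcov hE hhE SE hSE hsum
  have h1 := hmt (max t₂ 1) (le_max_left _ _)
  simp only [hS0, mul_zero, tsum_zero] at h1
  have : 0 < m * max t₂ 1 := mul_pos hm (lt_of_lt_of_le one_pos (le_max_right _ _))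
  linarith

/-! ## §2  The a.e.-carrier clause of `PreservesMeasure` is load-bearing (identity-flow witness) -/

/-- `LinearSpread` with `D.PreservesMeasure μ` WEAKENED to its second clause
`∀ t, MeasurePreserving (D.flow t) μ μ` (dropping "`μ`-a.e. configuration lies in the carrier of `D`", the only
clause that ties `D.flow` to Newton's equations, since `InfiniteChainDynamics` constrains the flow on its carrier
alone); everything else verbatim. -/
def LinearSpreadWithoutCarrierAE : Prop :=
  ∀ ω₂ lam β γ : ℝ, 0 < ω₂ → 0 < lam → 0 < β → ∀ T : ℝ, 0 < T →
  ∀ μ : Measure ChainConfig, (pinnedChain ω₂ lam β γ).IsChainGibbsMeasure T μ → IsShiftInvariant μ →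
  μ.map (fun σ : ChainConfig => fun x : ℤ => ((σ x).1, -(σ x).2)) = μ →
  ∀ D : InfiniteChainDynamics (pinnedChain ω₂ lam β γ), (∀ t : ℝ, MeasurePreserving (D.flow t) μ μ) →
  (∀ t : ℝ, ∀ᵐ σ ∂μ, D.flow t (shift σ) = shift (D.flow t σ)) →
  ∀ h : ChainConfig → ℤ → ℝ, h = (fun (σ : ChainConfig) (x : ℤ) => (σ x).2 ^ 2 / 2 +
    (pinnedChain ω₂ lam β γ).U (σ x).1 + ((pinnedChain ω₂ lam β γ).V ((σ (x + 1)).1 - (σ x).1) +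
    (pinnedChain ω₂ lam β γ).V ((σ x).1 - (σ (x - 1)).1)) / 2) →
  ∀ S : ℤ → ℝ → ℝ, S = (fun (x : ℤ) (t : ℝ) => ∫ σ, (h σ 0 - ∫ σ', h σ' 0 ∂μ) *
    (h (D.flow t σ) x - ∫ σ', h σ' 0 ∂μ) ∂μ) →
  (∀ t : ℝ, Summable (fun x : ℤ => (1 + (x : ℝ) ^ 2) * |S x t|)) →
  ∃ m t₂ : ℝ, 0 < m ∧ ∀ t : ℝ, t₂ ≤ t → m * t ≤ ∑' x : ℤ, (x : ℝ) ^ 2 * S x t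

/-- The IDLE dynamics of any chain: empty carrier, identity flow at every time (all four dynamical fields of
`InfiniteChainDynamics` are vacuous on the empty carrier). [folklore] -/
def idleDynamics (P : OscillatorChain) : InfiniteChainDynamics P where
  carrier := ∅
  flow := fun _ σ => σ
  mapsTo := fun _ => mapsTo_empty _ _
  flow_zero := fun _ h => (notMem_empty _ h).elim
  isSolution := fun _ h => (notMem_empty _ h).elim
  unique := fun _ hγ _ _ => (notMem_empty _ (hγ 0)).elim

/-- **The a.e.-carrier clause is load-bearing.**  `LinearSpreadWithoutCarrierAE` is FALSE: at
`ω₂ = lam = β = T = 1`, `γ = 0`, take the GENUINE shift-invariant superstable DLR state `μ` of the tree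
(`exists_isChainGibbsMeasure_shiftInvariant_superstable_pinnedChain`; reversal invariant by uniqueness of the
shift-invariant DLR state) and the IDLE dynamics (empty carrier, `φ_t = id`): every `φ_t` preserves `μ` and commutes
with the shift, the pulse is the STATIC covariance `S(x,t) = Cov_μ(h_0,h_x)` at every `t`, the guard
`Σ(1+x²)|S| < ∞` is the landed static-pulse summability (`summable_one_add_sq_mul_abs_staticPulse`, through the
Buttà–Marchioro dynamics whose `φ_0 = id` a.e.), and `M(t) = M(0)` is CONSTANT, so no `m > 0` has `m·t ≤ M(t)`
eventually.  Moral: measure preservation + every symmetry of the crux do not move energy; a proof must USE that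
`μ`-a.e. orbit solves the equations of motion (the clause `∀ᵐ σ ∂μ, σ ∈ D.carrier`), i.e. genuinely dynamical
input — complementary to `Theorems/LinearSpread/Negative/JunkDynamicsExcluded.lean` (frozen flows are excluded BY
that clause). [folklore] -/
theorem linearSpread_false_without_carrierAE : ¬ LinearSpreadWithoutCarrierAE := by
  intro H
  set P : OscillatorChain := pinnedChain 1 1 1 0 with hP
  obtain ⟨μ, hG, hS, hss⟩ :=
    OscillatorChain.exists_isChainGibbsMeasure_shiftInvariant_superstable_pinnedChain (0:ℝ) one_pos
      zero_le_one zero_le_one one_pos (ω₂ := 1) (lam := 1) (β := 1) (T := 1)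
  haveI : IsProbabilityMeasure μ := hG.isProbabilityMeasure
  -- reversal invariance from uniqueness of the shift-invariant DLR state
  have huniq : ∀ μ₁ μ₂ : Measure ChainConfig,
      P.IsChainGibbsMeasure 1 μ₁ → IsShiftInvariant μ₁ → P.HasSuperstabilityEstimate μ₁ →
      P.IsChainGibbsMeasure 1 μ₂ → IsShiftInvariant μ₂ → P.HasSuperstabilityEstimate μ₂ → μ₁ = μ₂ :=
    fun μ₁ μ₂ h₁ s₁ _ h₂ s₂ _ =>
      OscillatorChain.eq_of_isChainGibbsMeasure_of_isShiftInvariant_pinnedChain 0 one_pos zero_le_one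
        zero_le_one one_pos h₁ s₁ h₂ s₂
  have hR : μ.map momentumReversalZ = μ :=
    OscillatorChain.map_momentumReversalZ_eq_of_regular_unique hG hS hss huniq
  have hR' : μ.map (fun σ : ChainConfig => fun x : ℤ => ((σ x).1, -(σ x).2)) = μ := hR
  -- the genuine (Buttà–Marchioro) dynamics, used only to import the static guard
  have hU1 : OscillatorChain.IsEvenPolyOfDegree P.U 2 :=
    OscillatorChain.pinnedChain_isEvenPolyOfDegree_U (1:ℝ) (0:ℝ) zero_le_one one_pos
  have hV1 : OscillatorChain.IsEvenPolyOfDegree P.V 2 :=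
    OscillatorChain.pinnedChain_isEvenPolyOfDegree_V (1:ℝ) (1:ℝ) (0:ℝ) one_pos
  obtain ⟨D₀, -, -, -, -, -, -, hpres⟩ :=
    OscillatorChain.exists_bmDynamics (by norm_num) (by norm_num) hU1 hV1
  have hD₀ : D₀.PreservesMeasure μ := hpres 1 μ hG hss
  -- the idle dynamics and the crux's data
  set D : InfiniteChainDynamics P := idleDynamics P with hD
  have hmp : ∀ t : ℝ, MeasurePreserving (D.flow t) μ μ := fun _ => MeasurePreserving.id μ
  have hcov : ∀ t : ℝ, ∀ᵐ σ ∂μ, D.flow t (shift σ) = shift (D.flow t σ) :=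
    fun _ => Eventually.of_forall fun _ => rfl
  obtain ⟨hE, hhE⟩ : ∃ hE : ChainConfig → ℤ → ℝ, hE = (fun (σ : ChainConfig) (x : ℤ) =>
      (σ x).2 ^ 2 / 2 + P.U (σ x).1 + (P.V ((σ (x + 1)).1 - (σ x).1) +
        P.V ((σ x).1 - (σ (x - 1)).1)) / 2) := ⟨_, rfl⟩
  have hhE' : hE = fun σ x => P.energyDensityZ σ x := hhE
  obtain ⟨s, hs⟩ : ∃ s : ℤ → ℝ, s = (fun x : ℤ =>
      ∫ σ, (hE σ 0 - ∫ σ', hE σ' 0 ∂μ) * (hE σ x - ∫ σ', hE σ' 0 ∂μ) ∂μ) := ⟨_, rfl⟩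
  have hSdef : (fun (x : ℤ) (_ : ℝ) => s x) = (fun (x : ℤ) (t : ℝ) =>
      ∫ σ, (hE σ 0 - ∫ σ', hE σ' 0 ∂μ) * (hE (D.flow t σ) x - ∫ σ', hE σ' 0 ∂μ) ∂μ) := by
    rw [hs]
    rfl
  -- the guard: static-pulse summability, landed (via `D₀`, whose `φ_0 = id` a.e.)
  have hsum : Summable fun x : ℤ => (1 + (x : ℝ) ^ 2) * |s x| := by
    have h0 := Summit.AtomisticToContinuum.FouriersLaw.Theorems.AbelSpreadCeiling.RegularityCollapse.summable_one_add_sq_mul_abs_staticPulse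
      one_pos one_pos one_pos one_pos hG hS D₀ hD₀ hhE'
    refine h0.congr fun x => ?_
    rw [hs]
    congr 2
    refine integral_congr_ae ?_
    filter_upwards [D₀.flow_zero_ae_eq hD₀] with σ hσ
    rw [hσ]
  obtain ⟨m, t₂, hm, hmt⟩ := H 1 1 1 0 one_pos one_pos one_pos 1 one_pos μ hG hS hR' D hmp hcov hE hhE
    (fun x _ => s x) hSdef (fun _ => hsum)
  set M₀ : ℝ := ∑' x : ℤ, (x : ℝ) ^ 2 * s x with hM₀
  have h1 := hmt (max t₂ (M₀ / m + 1)) (le_max_left _ _)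
  have h2 : m * (M₀ / m + 1) ≤ m * max t₂ (M₀ / m + 1) :=
    mul_le_mul_of_nonneg_left (le_max_right _ _) hm.le
  have h3 : m * (M₀ / m + 1) = M₀ + m := by field_simp
  linarith

/-! ## §3  Line `KaramataCollapse`: IO ∧ ceiling do not give the envelope without Abel regularity (landed) -/

/-- Restatement (by the landed theorem) of the refuted natural strengthening: finite spectral measure + linear
ceiling + infinitely-often linear growth ⇏ eventual linear lower envelope. [folklore] -/
example :
    ¬ (∀ ρ : MeasureTheory.Measure ℝ, MeasureTheory.IsFiniteMeasure ρ → ∀ V : ℝ → ℝ,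
        V = (fun τ : ℝ => 2 * ∫ s in Set.Ioc (0:ℝ) τ, (τ - s) * ∫ w : ℝ, Real.cos (w * s) ∂ρ) →
        (∃ b : ℝ, ∀ t : ℝ, 0 ≤ t → V t ≤ b * (1 + t)) →
        (∃ m₀ : ℝ, 0 < m₀ ∧ ∀ t₀ : ℝ, ∃ t : ℝ, t₀ ≤ t ∧ m₀ * t ≤ V t) →
        ∃ m t₂ : ℝ, 0 < m ∧ ∀ t : ℝ, t₂ ≤ t → m * t ≤ V t) :=
  Summit.AtomisticToContinuum.FouriersLaw.Theorems.LinearSpread.Negative.not_linearEnvelope_of_io_and_ceiling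

/-- Restatement: the registered stub K with its Abel hypothesis deleted is false. [folklore] -/
example :
    ¬ (∀ (f σ : ℝ → ℝ), (∀ t : ℝ, 0 ≤ t → 0 ≤ σ t) →
      (∀ s t : ℝ, 0 ≤ s → s ≤ t → |σ t - σ s| ≤ σ (t - s)) →
      (∀ t : ℝ, 0 ≤ t → f t = σ t ^ 2) →
      (∃ b : ℝ, ∀ t : ℝ, 0 ≤ t → f t ≤ b * (1 + t)) →
      (∀ ν : ℝ, 0 < ν → MeasureTheory.IntegrableOn (fun t : ℝ => Real.exp (-(ν * t)) * f t) (Set.Ioi 0)) →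
      (∃ m₀ : ℝ, 0 < m₀ ∧ ∀ t₀ : ℝ, ∃ t : ℝ, t₀ ≤ t ∧ m₀ * t ≤ f t) →
      ∃ m t₂ : ℝ, 0 < m ∧ ∀ t : ℝ, t₂ ≤ t → m * t ≤ f t) :=
  Summit.AtomisticToContinuum.FouriersLaw.Theorems.LinearSpread.Negative.stub_karamataCollapse_false_without_abel

/-- Stub K without its infinitely-often hypothesis is trivially false (`f = σ ≡ 0`): the analysis stubs alone carry
no positivity — recorded for completeness of the load-bearing table of the line. [folklore] -/
theorem stub_karamataCollapse_false_without_io :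
    ¬ (∀ (f σ : ℝ → ℝ), (∀ t : ℝ, 0 ≤ t → 0 ≤ σ t) →
      (∀ s t : ℝ, 0 ≤ s → s ≤ t → |σ t - σ s| ≤ σ (t - s)) →
      (∀ t : ℝ, 0 ≤ t → f t = σ t ^ 2) →
      (∃ b : ℝ, ∀ t : ℝ, 0 ≤ t → f t ≤ b * (1 + t)) →
      (∀ ν : ℝ, 0 < ν → MeasureTheory.IntegrableOn (fun t : ℝ => Real.exp (-(ν * t)) * f t) (Set.Ioi 0)) →
      ((∃ L : ℝ, Tendsto (fun ν : ℝ => ν ^ 2 * ∫ t in Set.Ioi (0:ℝ), Real.exp (-(ν * t)) * f t)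
          (𝓝[>] 0) (𝓝 L)) ∨
        Tendsto (fun ν : ℝ => ν ^ 2 * ∫ t in Set.Ioi (0:ℝ), Real.exp (-(ν * t)) * f t) (𝓝[>] 0) atTop) →
      ∃ m t₂ : ℝ, 0 < m ∧ ∀ t : ℝ, t₂ ≤ t → m * t ≤ f t) := by
  intro h
  obtain ⟨m, t₂, hm, hmt⟩ := h (fun _ => 0) (fun _ => 0) (fun _ _ => le_rfl)
    (fun s t _ _ => by simp) (fun _ _ => by simp) ⟨0, fun t _ => by simp⟩
    (fun ν _ => by simp)
    (Or.inl ⟨0, by simp⟩)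
  have h1 := hmt (max t₂ 1) (le_max_left _ _)
  have : 0 < m * max t₂ 1 := mul_pos hm (lt_of_lt_of_le one_pos (le_max_right _ _))
  linarith

end Summit.AtomisticToContinuum.FouriersLaw.Cruxes.LinearSpread.Disproof

end
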